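import Summits.FinalStateConjecture.FinalStateConjecture.Theorems.ClusterCompletenessOmegaLimitMultiKerrLimitIsMetric
import HarnessLib

/-!
# Route ClusterCompleteness · crux `OmegaLimitMultiKerr` — at rest the crux's `1/4` anchor beats
# the Kerr–Schild margin on the whole exterior (nondegeneracy without recurrence instants)

Structure lemmas for the crux stmt-FinalStateConjecture-14664 (`ClusterCompleteness.OmegaLimitMultiKerr`),
line `Sketch`, lead gen 4, registered stub `isInvertible_add_kerrBilin_of_norm_le_quarter` (closed
form).

The recur-disjunct `Recurs k 𝒟` of the crux (`…OmegaLimitMultiKerrDefs`) anchors every hole chart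
in `C⁰` at ALL late times, `‖Ψᵢ^* 𝐠(x) − g_{Mᵢ,aᵢ,Λᵢ,cᵢ}(x)‖ ≤ 1/4` on the certified slabs
(operator norm in the Euclidean coordinates of `E4`). The file `…OmegaLimitMultiKerrLimitIsMetric`
turns "anchor `<` nondegeneracy MARGIN of the reference form" into invertibility of anchored chart
values and of anchored ω-limit chart metrics (`isInvertible_add_boostedKerrBilin_of_norm_lt`,
`…_of_mul_lt_one`, `isMetricOn_hole_omegaLimit_add_boostedKerrBilin`), leaving the margin
hypothesis `cst < m(x)` as a restriction of the region `V`. For FAST holes it is a genuine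
restriction (the boosted-horizon idleness witness `…OmegaLimitMultiKerrAnchorMargin`: a boosted
configuration with margin `≤ 1/8` and a degenerate `1/8`-perturbation). This file is the POSITIVE
COUNTERPART: for holes AT REST (`Λ = 1`, `c = 0`) with `a² ≤ (8/9)M²` (which covers `a = 0.9M`)
the crux's absolute `1/4` anchor beats the Kerr–Schild margin on the WHOLE exterior, so anchored
chart values and anchored ω-limit chart metrics are nondegenerate there without using the
recurrence instants:

* `four_div_three_mul_le_rPlus` — `a² ≤ (8/9)M²` gives `√(M² − a²) ≥ M/3`, i.e. `r₊ ≥ 4M/3`;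
* `one_add_four_mul_abs_scalarH_lt_four` — hence on the exterior `r > r₊ ≥ 4M/3`,
  `|H| ≤ M/r < 3/4` (`SublinearIsFree.Slaving.abs_scalarH_le`) and the Kerr–Schild coercivity
  constant `1 + 4|H(x)|` of `SublinearIsFree.Slaving.norm_le_mul_norm_kerr_bilin`
  (`‖v‖ ≤ (1 + 4|H|)‖g_{M,a}(x)(v, ·)‖`) is `< 4`;
* `exists_quarter_lt_mul_norm_le_norm_kerrBilin` — so every exterior point carries a margin
  `m > 1/4` (namely `m(x) = (1 + 4|H(x)|)⁻¹`) with `m‖v‖ ≤ ‖g_{M,a}(x)(v, ·)‖`;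
* `isInvertible_add_kerrBilin_of_norm_le_quarter` (MAIN, registered, closed form) — for
  `x ∈ Kerr.exterior M a` and ANY bilinear `G` with `‖G‖ ≤ 1/4`, `G + g_{M,a}(x)` is invertible
  (`isInvertible_add_of_norm_le_mul` with `‖G‖(1 + 4|H|) ≤ (1/4)(1 + 4|H|) < 1`; O'Neill 1983,
  Ch. 3, Lemma 3.4);
* the crux's boosted vocabulary with the trivial motion `(1, 0)` (`boostedKerrBilin_one_zero`,
  `boostedKerrExterior_one_zero`): `mem_exterior_of_mem_boostedKerrExterior_one_zero`,
  the margin function `inv_mul_norm_le_norm_boostedKerrBilin_one_zero` /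
  `quarter_lt_inv_one_add_four_mul_abs_scalarH`,
  `isInvertible_add_boostedKerrBilin_one_zero_of_norm_le_quarter` (anchored chart values) and
  `isInvertible_add_boostedKerrBilin_one_zero_of_tendsto` (anchored limits, `‖Gᵢ‖ ≤ 1/4`
  eventually, `Gᵢ → G`);
* `isMetricOn_omegaLimit_add_boostedKerrBilin_of_rest` /
  `isMetricOn_hole_omegaLimit_add_boostedKerrBilin_of_rest` /
  `isMetricOn_hole_omegaLimit_add_boostedKerrBilin_exterior_of_rest` — the ω-LIMIT COROLLARY at
  rest: a `1/4`-anchored smooth ω-limit `g` of the deviation translates of a hole chart on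
  `boostedKerrBackground 1 0 M a` defines a field of metric components `g + g_{M,a}`
  (`MetricCoord.IsMetricOn`) on every open `V` inside the exterior on which the translates are
  anchored (in particular on the whole exterior) — the margin hypothesis of
  `isMetricOn_(hole_)omegaLimit_add_boostedKerrBilin`, which feeds the vacuum chain
  `ricAt_hole_omegaLimit_eq_zero`, is automatic for holes at rest with `a² ≤ (8/9)M²`.

Everything is proved; Mathlib + landed `Literature` / `Theorems` files only, no definitions.

## References
* B. O'Neill, *Semi-Riemannian geometry with applications to relativity*, Academic Press 1983,
  Ch. 3, Def. 3.1 and Lemma 3.4 (metric tensors; nondegenerate ⇔ invertible). [ONeill1983]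
* R. P. Kerr, A. Schild, *A new class of vacuum solutions of the Einstein field equations*, 1965,
  §2 (`g = η + 2Hℓ ⊗ ℓ`). [KerrSchild1965]
* J. K. Hale, *Ordinary differential equations*, 2nd ed., Krieger 1980, Ch. I, §8 (ω-limit sets
  inherit closed constraints). [Hale1980]
-/

-- every `Summit.FinalStateConjecture.FinalStateConjecture.…` name repeats the summit = sub-problem segment (D-0017 layout)
set_option linter.dupNamespace false
-- the normed-group instances on `E →L[ℝ] E →L[ℝ] ℝ` need one more level of pending instance
-- problems than the default (as in `CoordCurvature.lean`)
set_option maxSynthPendingDepth 3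

noncomputable section

open scoped Manifold ContDiff Topology ENNReal
open Set Filter TopologicalSpace

namespace Summit.FinalStateConjecture.FinalStateConjecture.Theorems.ClusterCompleteness

open Literature.Geometry.Lorentzian

/-! ### The Kerr–Schild coercivity constant on the exterior of a slowly spinning hole -/

/-- **Slow spin keeps the horizon large**: for `a² ≤ (8/9)M²` one has `(M/3)² ≤ M² − a²`, so
`M/3 ≤ √(M² − a²)` and `4M/3 ≤ r₊ = M + √(M² − a²)`. [folklore] -/
theorem four_div_three_mul_le_rPlus {M a : ℝ} (ha : a ^ 2 ≤ 8 / 9 * M ^ 2) :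
    4 / 3 * M ≤ Kerr.rPlus M a := by
  have hs : M / 3 ≤ √(M ^ 2 - a ^ 2) := Real.le_sqrt_of_sq_le (by nlinarith)
  unfold Kerr.rPlus
  linarith

/-- **On the exterior of a slowly spinning hole the Kerr–Schild coercivity constant is below `4`**:
for `0 < M`, `a² ≤ (8/9)M²` and `x ∈ Kerr.exterior M a` (`r(x) > r₊ ≥ 4M/3`,
`four_div_three_mul_le_rPlus`), `|H(x)| ≤ M/r(x) < 3/4` (`H = M r³/(r⁴ + a²z²)`,
`SublinearIsFree.Slaving.abs_scalarH_le`), hence `1 + 4|H(x)| < 4`. [folklore] -/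
theorem one_add_four_mul_abs_scalarH_lt_four {M a : ℝ} (hM : 0 < M) (ha : a ^ 2 ≤ 8 / 9 * M ^ 2)
    {x : E4} (hx : x ∈ Kerr.exterior M a) : 1 + 4 * |Kerr.scalarH M a x| < 4 := by
  have h := Kerr.mem_exterior.1 hx
  have hr : Kerr.rPlus M a < Kerr.radius a x := (le_max_left _ _).trans_lt h
  have hr0 : 0 < Kerr.radius a x := (le_max_right _ _).trans_lt h
  have h43 : 4 / 3 * M < Kerr.radius a x := (four_div_three_mul_le_rPlus ha).trans_lt hr
  have hH : |Kerr.scalarH M a x| ≤ |M| / Kerr.radius a x :=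
    SublinearIsFree.Slaving.abs_scalarH_le M a hr0
  rw [abs_of_pos hM] at hH
  have hlt : M / Kerr.radius a x < 3 / 4 := by
    rw [div_lt_iff₀ hr0]
    linarith
  linarith

/-- **Pointwise margin above the anchor**: for `0 < M`, `a² ≤ (8/9)M²` and `x ∈ Kerr.exterior M a`
there is `m > 1/4` (namely `m = (1 + 4|H(x)|)⁻¹`) with `m‖v‖ ≤ ‖g_{M,a}(x)(v, ·)‖` for all `v`
(`SublinearIsFree.Slaving.norm_le_mul_norm_kerr_bilin`: `‖v‖ ≤ (1 + 4|H|)‖g_{M,a}(x)(v, ·)‖`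
wherever `r > 0`, and `one_add_four_mul_abs_scalarH_lt_four`): the nondegeneracy margin of the
Kerr–Schild form beats the crux's absolute `C⁰` anchor `1/4` at every exterior point of a hole at
rest (Kerr–Schild 1965, §2, `g = η + 2Hℓ ⊗ ℓ` with `ℓ` null). [folklore] -/
theorem exists_quarter_lt_mul_norm_le_norm_kerrBilin {M a : ℝ} (hM : 0 < M)
    (ha : a ^ 2 ≤ 8 / 9 * M ^ 2) {x : E4} (hx : x ∈ Kerr.exterior M a) :
    ∃ m : ℝ, 1 / 4 < m ∧ ∀ v : E4, m * ‖v‖ ≤ ‖Kerr.bilin M a x v‖ := by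
  have hL : 0 < 1 + 4 * |Kerr.scalarH M a x| := by positivity
  refine ⟨(1 + 4 * |Kerr.scalarH M a x|)⁻¹, ?_, fun v ↦ ?_⟩
  · rw [one_div, inv_lt_inv₀ four_pos hL]
    exact one_add_four_mul_abs_scalarH_lt_four hM ha hx
  · rw [inv_mul_le_iff₀ hL]
    exact SublinearIsFree.Slaving.norm_le_mul_norm_kerr_bilin M a
      (Kerr.radius_pos_of_mem_region hx) v

/-! ### Anchored chart values at rest are nondegenerate on the whole exterior -/

/-- **At rest the `1/4` anchor beats the Kerr–Schild margin on the whole exterior** (registered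
structure stub of line `Sketch`, crux stmt-FinalStateConjecture-14664, closed form). For `0 < M`,
`a² ≤ (8/9)M²` (covers `a = 0.9M`), `x ∈ Kerr.exterior M a` and any bilinear `G` with `‖G‖ ≤ 1/4`
(operator norm in the Euclidean coordinates of `E4`), the form `G + g_{M,a}(x)` is invertible:
`‖v‖ ≤ (1 + 4|H(x)|)‖g_{M,a}(x)(v, ·)‖` (`SublinearIsFree.Slaving.norm_le_mul_norm_kerr_bilin`) with
`1 + 4|H(x)| < 4` (`one_add_four_mul_abs_scalarH_lt_four`), so `‖G‖(1 + 4|H(x)|) < 1` and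
`isInvertible_add_of_norm_le_mul` applies (injective ⇒ nondegenerate ⇒ invertible; O'Neill 1983,
Ch. 3, Lemma 3.4). Positive counterpart of the boosted-horizon idleness witness
(`…OmegaLimitMultiKerrAnchorMargin`): for holes AT REST with `a² ≤ (8/9)M²` the crux's absolute
`C⁰` anchor makes anchored chart values `Ψ^* 𝐠(x) = G + g_{M,a}(x)` nondegenerate on the whole
exterior, without using the recurrence instants. [cite: ONeill1983, Ch. 3 Lemma 3.4] -/
theorem isInvertible_add_kerrBilin_of_norm_le_quarter :
    ∀ {M a : ℝ}, 0 < M → a ^ 2 ≤ 8 / 9 * M ^ 2 → ∀ {x : E4}, x ∈ Kerr.exterior M a →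
      ∀ {G : E4 →L[ℝ] E4 →L[ℝ] ℝ}, ‖G‖ ≤ 1 / 4 → (G + Kerr.bilin M a x).IsInvertible := by
  intro M a hM ha x hx G hG
  have hL := one_add_four_mul_abs_scalarH_lt_four hM ha hx
  have hL0 : 0 < 1 + 4 * |Kerr.scalarH M a x| := by positivity
  rw [add_comm]
  refine isInvertible_add_of_norm_le_mul
    (SublinearIsFree.Slaving.norm_le_mul_norm_kerr_bilin M a (Kerr.radius_pos_of_mem_region hx)) ?_
  calc ‖G‖ * (1 + 4 * |Kerr.scalarH M a x|) ≤ 1 / 4 * (1 + 4 * |Kerr.scalarH M a x|) :=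
        mul_le_mul_of_nonneg_right hG hL0.le
    _ < 1 / 4 * 4 := mul_lt_mul_of_pos_left hL (by norm_num)
    _ = 1 := by norm_num

/-! ### The crux's boosted vocabulary with the trivial motion `(1, 0)` -/

/-- For the trivial motion the boosted exterior is the Kerr exterior, membership form of
`boostedKerrExterior_one_zero` (`poincareInv 1 0 = id`). [folklore] -/
theorem mem_exterior_of_mem_boostedKerrExterior_one_zero {M a : ℝ} {x : E4}
    (hx : x ∈ (boostedKerrExterior 1 0 M a : Set E4)) : x ∈ Kerr.exterior M a := by
  have h : poincareInv 1 0 x ∈ Kerr.exterior M a := mem_boostedKerrExterior.1 hx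
  rwa [poincareInv_one_zero] at h

/-- **The at-rest margin function** `m(x) = (1 + 4|H(x)|)⁻¹` in the boosted vocabulary: on
`boostedKerrExterior 1 0 M a` it satisfies `m(x)‖v‖ ≤ ‖boostedKerrBilin 1 0 M a x (v, ·)‖`
(`SublinearIsFree.Slaving.norm_le_mul_norm_kerr_bilin`, `boostedKerrBilin_one_zero`). [folklore] -/
theorem inv_mul_norm_le_norm_boostedKerrBilin_one_zero (M a : ℝ) {x : E4}
    (hx : x ∈ (boostedKerrExterior 1 0 M a : Set E4)) (v : E4) :
    (1 + 4 * |Kerr.scalarH M a x|)⁻¹ * ‖v‖ ≤ ‖boostedKerrBilin 1 0 M a x v‖ := by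
  have hL : 0 < 1 + 4 * |Kerr.scalarH M a x| := by positivity
  rw [boostedKerrBilin_one_zero, inv_mul_le_iff₀ hL]
  exact SublinearIsFree.Slaving.norm_le_mul_norm_kerr_bilin M a
    (Kerr.radius_pos_of_mem_region (mem_exterior_of_mem_boostedKerrExterior_one_zero hx)) v

/-- **… and it beats the anchor**: `1/4 < (1 + 4|H(x)|)⁻¹` on `boostedKerrExterior 1 0 M a` for
`0 < M`, `a² ≤ (8/9)M²` (`one_add_four_mul_abs_scalarH_lt_four`). [folklore] -/
theorem quarter_lt_inv_one_add_four_mul_abs_scalarH {M a : ℝ} (hM : 0 < M)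
    (ha : a ^ 2 ≤ 8 / 9 * M ^ 2) {x : E4} (hx : x ∈ (boostedKerrExterior 1 0 M a : Set E4)) :
    1 / 4 < (1 + 4 * |Kerr.scalarH M a x|)⁻¹ := by
  have hL : 0 < 1 + 4 * |Kerr.scalarH M a x| := by positivity
  rw [one_div, inv_lt_inv₀ four_pos hL]
  exact one_add_four_mul_abs_scalarH_lt_four hM ha
    (mem_exterior_of_mem_boostedKerrExterior_one_zero hx)

/-- **Anchored chart values at rest, boosted vocabulary**: for `0 < M`, `a² ≤ (8/9)M²`,
`x ∈ boostedKerrExterior 1 0 M a` and `‖G‖ ≤ 1/4`, the form `G + boostedKerrBilin 1 0 M a x` is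
invertible (`isInvertible_add_kerrBilin_of_norm_le_quarter` through `boostedKerrBilin_one_zero`;
O'Neill 1983, Ch. 3, Lemma 3.4). [cite: ONeill1983, Ch. 3 Lemma 3.4] -/
theorem isInvertible_add_boostedKerrBilin_one_zero_of_norm_le_quarter {M a : ℝ} (hM : 0 < M)
    (ha : a ^ 2 ≤ 8 / 9 * M ^ 2) {x : E4} (hx : x ∈ (boostedKerrExterior 1 0 M a : Set E4))
    {G : E4 →L[ℝ] E4 →L[ℝ] ℝ} (hG : ‖G‖ ≤ 1 / 4) :
    (G + boostedKerrBilin 1 0 M a x).IsInvertible := by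
  rw [boostedKerrBilin_one_zero]
  exact isInvertible_add_kerrBilin_of_norm_le_quarter hM ha
    (mem_exterior_of_mem_boostedKerrExterior_one_zero hx) hG

/-- **Anchored limits at rest are nondegenerate on the whole exterior**: if `Gᵢ → G` along a
nontrivial filter with `‖Gᵢ‖ ≤ 1/4` eventually (the crux's all-time `C⁰` anchor on the deviation
translates; `‖G‖ ≤ 1/4` since closed balls are closed, Hale 1980, Ch. I, §8) and
`x ∈ boostedKerrExterior 1 0 M a`, `0 < M`, `a² ≤ (8/9)M²`, then `G + boostedKerrBilin 1 0 M a x`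
is invertible (`isInvertible_add_boostedKerrBilin_of_tendsto` with the margin
`(1 + 4|H(x)|)⁻¹ > 1/4`). [cite: Hale1980, Ch. I §8] -/
theorem isInvertible_add_boostedKerrBilin_one_zero_of_tendsto {M a : ℝ} (hM : 0 < M)
    (ha : a ^ 2 ≤ 8 / 9 * M ^ 2) {ι : Type*} {l : Filter ι} [l.NeBot] {x : E4}
    (hx : x ∈ (boostedKerrExterior 1 0 M a : Set E4)) {Gs : ι → E4 →L[ℝ] E4 →L[ℝ] ℝ}
    {G : E4 →L[ℝ] E4 →L[ℝ] ℝ} (hlim : Tendsto Gs l (𝓝 G)) (hb : ∀ᶠ i in l, ‖Gs i‖ ≤ 1 / 4) :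
    (G + boostedKerrBilin 1 0 M a x).IsInvertible :=
  isInvertible_add_boostedKerrBilin_of_tendsto 1 0 M a hlim hb
    (inv_mul_norm_le_norm_boostedKerrBilin_one_zero M a hx)
    (quarter_lt_inv_one_add_four_mul_abs_scalarH hM ha hx)

/-! ### The ω-limit corollary: anchored ω-limits at rest are metrics, no margin hypothesis -/

/-- **Anchored ω-limits at rest are metrics on the whole anchored region** (any filter of
translates). Let `Ψ` be a hole chart on the Kerr background at rest `boostedKerrBackground 1 0 M a`,
`0 < M`, `a² ≤ (8/9)M²`, `V` an open subset of the exterior, `g` of class `C^∞` on `V`, and along a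
nontrivial filter let the deviation translates `(Ψ^* 𝐠 − g_{M,a})(x + sᵢ • e)` converge to `g x`
and be eventually `1/4`-ANCHORED in norm at every `x ∈ V`. Then the limit chart metric
`g + g_{M,a}` is a field of metric components on `V` (`MetricCoord.IsMetricOn`; O'Neill 1983, Ch. 3,
Def. 3.1): `isMetricOn_omegaLimit_add_boostedKerrBilin` with the margin `m(x) = (1 + 4|H(x)|)⁻¹ > 1/4`
(`inv_mul_norm_le_norm_boostedKerrBilin_one_zero`, `quarter_lt_inv_one_add_four_mul_abs_scalarH`) —
NO margin hypothesis and no restriction of `V`. [cite: ONeill1983, Ch. 3 Def. 3.1] -/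
theorem isMetricOn_omegaLimit_add_boostedKerrBilin_of_rest {M a : ℝ} (hM : 0 < M)
    (ha : a ^ 2 ≤ 8 / 9 * M ^ 2) (𝓢 : Spacetime 4)
    (Ψ : (boostedKerrBackground 1 0 M a).domain → 𝓢.carrier) {g : E4 → E4 →L[ℝ] E4 →L[ℝ] ℝ}
    {V : Set E4} (hVo : IsOpen V) (hV : V ⊆ (boostedKerrExterior 1 0 M a : Set E4))
    (hg : ContDiffOn ℝ ∞ g V) {ι : Type*} {l : Filter ι} [l.NeBot] {s : ι → ℝ} {e : E4}
    (hlim : ∀ x ∈ V, Tendsto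
      (fun i ↦ 𝓢.deviationExtend (boostedKerrBackground 1 0 M a) Ψ (x + s i • e)) l (𝓝 (g x)))
    (hb : ∀ x ∈ V, ∀ᶠ i in l,
      ‖𝓢.deviationExtend (boostedKerrBackground 1 0 M a) Ψ (x + s i • e)‖ ≤ 1 / 4) :
    MetricCoord.IsMetricOn (fun x ↦ g x + boostedKerrBilin 1 0 M a x) V :=
  isMetricOn_omegaLimit_add_boostedKerrBilin 1 0 M a 𝓢 Ψ hVo hV hg hlim hb
    (fun _ hx ↦ inv_mul_norm_le_norm_boostedKerrBilin_one_zero M a (hV hx))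
    (fun _ hx ↦ quarter_lt_inv_one_add_four_mul_abs_scalarH hM ha (hV hx))

/-- **Sequential form in the crux's currency, at rest.** Let `g` be an ω-limit of the deviation
translates of a hole chart `Ψ` on `boostedKerrBackground 1 0 M a` (`0 < M`, `a² ≤ (8/9)M²`) along
chart times `T n`, in the `supCkENorm`-on-compacts sense of `exists_omegaLimit_hole_translate` /
`exists_smoothOmegaLimit_hole_translate` (any order `k`), with `g` of class `C^∞` on the exterior,
and let `V` be an open subset of the exterior on which the translates are eventually
`1/4`-ANCHORED, `‖(Ψ^* 𝐠 − g_{M,a})(x + T n • e)‖ ≤ 1/4`. Then `g + g_{M,a}` is a field of metric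
components on `V` — the hypothesis `MetricCoord.IsMetricOn (fun x ↦ g x + boostedKerrBilin 1 0 M a x) V`
of `ricAt_hole_omegaLimit_eq_zero` — with NO margin hypothesis: for holes at rest with
`a² ≤ (8/9)M²` the margin hypothesis of the vacuum chain is automatic
(`isMetricOn_hole_omegaLimit_add_boostedKerrBilin` with `m(x) = (1 + 4|H(x)|)⁻¹ > 1/4`; O'Neill 1983,
Ch. 3, Def. 3.1). [cite: ONeill1983, Ch. 3 Def. 3.1] -/
theorem isMetricOn_hole_omegaLimit_add_boostedKerrBilin_of_rest {M a : ℝ} (hM : 0 < M)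
    (ha : a ^ 2 ≤ 8 / 9 * M ^ 2) (𝓢 : Spacetime 4)
    (Ψ : (boostedKerrBackground 1 0 M a).domain → 𝓢.carrier) {g : E4 → E4 →L[ℝ] E4 →L[ℝ] ℝ}
    (hg : ContDiffOn ℝ ∞ g (boostedKerrExterior 1 0 M a : Set E4)) {V : Set E4} (hVo : IsOpen V)
    (hV : V ⊆ (boostedKerrExterior 1 0 M a : Set E4)) {k : ℕ} {T : ℕ → ℝ} {e : E4}
    (hlim : ∀ K ⊆ (boostedKerrExterior 1 0 M a : Set E4), IsCompact K →
      Tendsto (fun n ↦ supCkENorm K k (fun x ↦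
        𝓢.deviationExtend (boostedKerrBackground 1 0 M a) Ψ (x + T n • e) - g x)) atTop (𝓝 0))
    (hb : ∀ x ∈ V, ∀ᶠ n in atTop,
      ‖𝓢.deviationExtend (boostedKerrBackground 1 0 M a) Ψ (x + T n • e)‖ ≤ 1 / 4) :
    MetricCoord.IsMetricOn (fun x ↦ g x + boostedKerrBilin 1 0 M a x) V :=
  isMetricOn_hole_omegaLimit_add_boostedKerrBilin 1 0 M a 𝓢 Ψ hg hVo hV hlim hb
    (fun _ hx ↦ inv_mul_norm_le_norm_boostedKerrBilin_one_zero M a (hV hx))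
    (fun _ hx ↦ quarter_lt_inv_one_add_four_mul_abs_scalarH hM ha (hV hx))

/-- **On the whole exterior.** If the deviation translates of a hole chart at rest are eventually
`1/4`-anchored at EVERY exterior point (the crux's all-time `C⁰` anchor along chart times through
the certified slabs), then the at-rest limit chart metric `g + g_{M,a}` of a smooth ω-limit `g` is a
field of metric components on the WHOLE exterior `boostedKerrExterior 1 0 M a` (`= Kerr.exterior M a`,
`boostedKerrExterior_one_zero`): `isMetricOn_hole_omegaLimit_add_boostedKerrBilin_of_rest` with
`V` the exterior itself (O'Neill 1983, Ch. 3, Def. 3.1). [cite: ONeill1983, Ch. 3 Def. 3.1] -/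
theorem isMetricOn_hole_omegaLimit_add_boostedKerrBilin_exterior_of_rest {M a : ℝ} (hM : 0 < M)
    (ha : a ^ 2 ≤ 8 / 9 * M ^ 2) (𝓢 : Spacetime 4)
    (Ψ : (boostedKerrBackground 1 0 M a).domain → 𝓢.carrier) {g : E4 → E4 →L[ℝ] E4 →L[ℝ] ℝ}
    (hg : ContDiffOn ℝ ∞ g (boostedKerrExterior 1 0 M a : Set E4)) {k : ℕ} {T : ℕ → ℝ} {e : E4}
    (hlim : ∀ K ⊆ (boostedKerrExterior 1 0 M a : Set E4), IsCompact K →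
      Tendsto (fun n ↦ supCkENorm K k (fun x ↦
        𝓢.deviationExtend (boostedKerrBackground 1 0 M a) Ψ (x + T n • e) - g x)) atTop (𝓝 0))
    (hb : ∀ x ∈ (boostedKerrExterior 1 0 M a : Set E4), ∀ᶠ n in atTop,
      ‖𝓢.deviationExtend (boostedKerrBackground 1 0 M a) Ψ (x + T n • e)‖ ≤ 1 / 4) :
    MetricCoord.IsMetricOn (fun x ↦ g x + boostedKerrBilin 1 0 M a x)
      (boostedKerrExterior 1 0 M a : Set E4) :=
  isMetricOn_hole_omegaLimit_add_boostedKerrBilin_of_rest hM ha 𝓢 Ψ hg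
    (boostedKerrExterior 1 0 M a).isOpen subset_rfl hlim hb

end Summit.FinalStateConjecture.FinalStateConjecture.Theorems.ClusterCompleteness

end
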